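import Literature.Barriers.Parity.SiegelZeroDichotomyChowlaDivisorSums
import Literature.Barriers.Parity.SiegelZeroDichotomyChowlaTools
import Literature.NumberTheory.Sieve.DivisorBound
import HarnessLib

/-!
# Step (v) of Tao–Teräväinen at `k = 0`: Proposition 8.1 (`ℓ > 0`) from Lemma 3.7
# (`TaoTeravainen2021_prop81_k0` reduced to `TaoTeravainen2021_lemma37_k0`)

Topic `Literature/Barriers/Parity`; part of the proof DAG of
`Literature.Barriers.Parity.TaoTeravainen2021_chowla` (`SiegelZeroDichotomyChowla.lean`). PROVED here:

* `TaoTeravainen2021_prop81_k0_of_lemma37 : TaoTeravainen2021_lemma37_k0 → TaoTeravainen2021_prop81_k0`.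

This is §8 of the source in "the easy case `ℓ > 0`, in which `𝔖` vanishes", at `k = 0`: expand
`∏ⱼ λ♯_Siegel(n+h'ⱼ)` into Type I sums (`SiegelZeroDichotomyChowlaTypeI.lean`), bound each by
Lemma 3.7, and sum the divisor functions (`SiegelZeroDichotomyChowlaDivisorSums.lean`):
`|𝔼_{n ≤ x} ∏ⱼ λ♯(n+h'ⱼ)| ≤ M^ℓ C_ε (q^{-1/2+ε} (τ(q)²(1+log N)²)^ℓ + q^{1/2+ε} (N^{3/2}(1+log N))^ℓ/x)`
with `N = ⌊D⌋`, `D = x^{ε₀/(10ℓ)}`; then, as in the source ((2.9), (2.11) and (1.4)), with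
`ε = ε₀/10`, the divisor bound `τ(q) ≪ q^{1/(32ℓ)}`, `log x ≤ √η log q` and Siegel's theorem
`η ≪ q^{o(1)}` (here `exists_log_le_mul_log_conductor_add`), the first term is `≪ q^{-1/4}` and the
second `≪ x^{-ε₀/2} ≤ q^{-ε₀/4}`, both `≪ log^{-1/10} η`.
[cite: TaoTeravainen2021, §8 (the case ℓ > 0), (2.9), (2.11), (1.4)]
-/

noncomputable section

open Finset Real
open Literature.NumberTheory.Sieve (exists_card_divisors_le_mul_rpow)

namespace Literature.Barriers.Parity

/-! ### Siegel's theorem in the form `log η ≤ ε log q + c` -/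

/-- **(1.4) via Siegel's theorem, general `ε`**: for every `ε > 0` there is an (ineffective) `c`
such that every Siegel zero of quality `η` at conductor `q` has `log η ≤ ε log q + c` (MV Corollary
11.15: `C q^{-ε} ≤ 1 - β = 1/(η log q)`). [cite: TaoTeravainen2021, (1.4)] -/
theorem exists_log_le_mul_log_conductor_add {ε : ℝ} (hε : 0 < ε) :
    ∃ c : ℝ, ∀ (q : ℕ) [NeZero q] (χ : DirichletCharacter ℂ q) (η : ℝ), IsSiegelZero χ η →
      Real.log η ≤ ε * Real.log q + c := by
  obtain ⟨C, hC, hS⟩ :=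
    Literature.NumberTheory.LFunctions.Siegel.exists_one_sub_realZero_ge hε
  refine ⟨-Real.log (C * Real.log 2), fun q _ χ η h => ?_⟩
  have hq : (2 : ℝ) ≤ q := by exact_mod_cast (le_of_lt h.three_le : 2 ≤ q)
  have hq0 : (0 : ℝ) < q := by linarith
  have hlog2 : Real.log 2 ≤ Real.log q := Real.log_le_log two_pos hq
  have hl2 : 0 < Real.log 2 := Real.log_pos one_lt_two
  have hlogq : 0 < Real.log q := hl2.trans_le hlog2
  have hη : 0 < η := by linarith [h.ten_le]
  have key := hS q χ h.2.1.sq_eq_one h.ne_one (1 - 1 / (η * Real.log q)) h.2.2.2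
  rw [sub_sub_cancel] at key
  have hqε : 0 < (q : ℝ) ^ (-ε) := Real.rpow_pos_of_pos hq0 _
  -- `C q^{-ε} ≤ 1/(η log q)` gives `C η log q ≤ q^ε`, hence `η C log 2 ≤ q^ε`
  have h3 : C * (η * Real.log q) ≤ (q : ℝ) ^ ε := by
    have := mul_le_mul_of_nonneg_left key
      (by positivity : 0 ≤ (q : ℝ) ^ ε * (η * Real.log q))
    have hinv : (q : ℝ) ^ ε * (q : ℝ) ^ (-ε) = 1 := by
      rw [Real.rpow_neg hq0.le, mul_inv_cancel₀ (Real.rpow_pos_of_pos hq0 ε).ne']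
    calc C * (η * Real.log q) = (q : ℝ) ^ ε * (η * Real.log q) * (C * (q : ℝ) ^ (-ε)) := by
          calc C * (η * Real.log q) = ((q : ℝ) ^ ε * (q : ℝ) ^ (-ε)) * (C * (η * Real.log q)) := by
                rw [hinv, one_mul]
            _ = _ := by ring
      _ ≤ (q : ℝ) ^ ε * (η * Real.log q) * (1 / (η * Real.log q)) := this
      _ = (q : ℝ) ^ ε := by field_simp
  have h1 : η * (C * Real.log 2) ≤ (q : ℝ) ^ ε :=
    calc η * (C * Real.log 2) ≤ η * (C * Real.log q) := by gcongr
      _ = C * (η * Real.log q) := by ring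
      _ ≤ (q : ℝ) ^ ε := h3
  have hpos : 0 < C * Real.log 2 := mul_pos hC hl2
  calc Real.log η = Real.log (η * (C * Real.log 2)) - Real.log (C * Real.log 2) := by
        rw [Real.log_mul hη.ne' hpos.ne']; ring
    _ ≤ Real.log ((q : ℝ) ^ ε) - Real.log (C * Real.log 2) :=
        sub_le_sub_right (Real.log_le_log (mul_pos hη hpos) h1) _
    _ = ε * Real.log q + -Real.log (C * Real.log 2) := by rw [Real.log_rpow hq0]; ring

/-- **`q^{-ε} ≪_ε log^{-1/10} η`** over Siegel zeros (from the previous bound: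
`log η ≤ q^ε + |c|`, and `log^{1/10} η ≤ log η`). [cite: TaoTeravainen2021, (1.4) and (2.11)] -/
theorem exists_rpow_neg_le_div {ε : ℝ} (hε : 0 < ε) :
    ∃ K : ℝ, 0 ≤ K ∧ ∀ (q : ℕ) [NeZero q] (χ : DirichletCharacter ℂ q) (η : ℝ), IsSiegelZero χ η →
      (q : ℝ) ^ (-ε) ≤ K / Real.log η ^ ((1 : ℝ) / 10) := by
  obtain ⟨c, hc⟩ := exists_log_le_mul_log_conductor_add hε
  refine ⟨1 + |c|, by positivity, fun q _ χ η h => ?_⟩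
  have hq1 : (1 : ℝ) ≤ q := by exact_mod_cast NeZero.one_le
  have hq0 : (0 : ℝ) < q := by linarith
  have hη10 := h.ten_le
  have hL1 : 1 ≤ Real.log η := by
    rw [← Real.log_exp 1]
    refine Real.log_le_log (Real.exp_pos 1) (le_trans ?_ hη10)
    have := Real.exp_one_lt_d9; linarith
  have hL0 : 0 < Real.log η := by linarith
  have hqε1 : 1 ≤ (q : ℝ) ^ ε := Real.one_le_rpow hq1 hε.le
  have hqε0 : 0 < (q : ℝ) ^ ε := by linarith
  -- `log η ≤ ε log q + c ≤ q^ε + |c| ≤ (1 + |c|) q^ε`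
  have h1 : Real.log η ≤ (1 + |c|) * (q : ℝ) ^ ε := by
    have h2 : ε * Real.log q ≤ (q : ℝ) ^ ε := by
      have := Real.log_le_rpow_div hq0.le hε
      rwa [le_div_iff₀ hε, mul_comm] at this
    have h3 := hc q χ η h
    have h4 := le_abs_self c
    nlinarith [mul_nonneg (abs_nonneg c) (sub_nonneg.mpr hqε1)]
  have hL10 : Real.log η ^ ((1 : ℝ) / 10) ≤ Real.log η := by
    calc Real.log η ^ ((1 : ℝ) / 10) ≤ Real.log η ^ (1 : ℝ) :=
          Real.rpow_le_rpow_of_exponent_le hL1 (by norm_num)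
      _ = Real.log η := Real.rpow_one _
  have hLpos : 0 < Real.log η ^ ((1 : ℝ) / 10) := Real.rpow_pos_of_pos hL0 _
  rw [le_div_iff₀ hLpos, Real.rpow_neg hq0.le, inv_mul_le_iff₀ hqε0]
  exact hL10.trans (h1.trans_eq (mul_comm _ _))

/-- **`1 + log x ≪_γ q^γ` on the range `x ≤ q^{√η}`** over Siegel zeros: `log x ≤ √η log q`,
`√η ≪ q^{γ/2}` by Siegel ((1.4) with `ε = γ`) and `log q ≤ (2/γ) q^{γ/2}`.
[cite: TaoTeravainen2021, (1.4), (2.11)] -/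
theorem exists_one_add_log_le_rpow {γ : ℝ} (hγ : 0 < γ) :
    ∃ K : ℝ, 1 ≤ K ∧ ∀ (q : ℕ) [NeZero q] (χ : DirichletCharacter ℂ q) (η : ℝ), IsSiegelZero χ η →
      ∀ x : ℝ, 1 ≤ x → x ≤ (q : ℝ) ^ Real.sqrt η → 1 + Real.log x ≤ K * (q : ℝ) ^ γ := by
  obtain ⟨c, hc⟩ := exists_log_le_mul_log_conductor_add hγ
  refine ⟨1 + Real.exp (c / 2) * (2 / γ), ?_, fun q _ χ η h x hx1 hxq => ?_⟩
  · have : 0 ≤ Real.exp (c / 2) * (2 / γ) := by positivity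
    linarith
  have hq1 : (1 : ℝ) ≤ q := by exact_mod_cast NeZero.one_le
  have hq0 : (0 : ℝ) < q := by linarith
  have hη0 : 0 < η := by linarith [h.ten_le]
  have hlogq0 : 0 ≤ Real.log q := Real.log_nonneg hq1
  -- `log x ≤ √η log q`
  have hlogx : Real.log x ≤ Real.sqrt η * Real.log q := by
    have := Real.log_le_log (by linarith) hxq
    rwa [Real.log_rpow hq0] at this
  -- `√η ≤ e^{c/2} q^{γ/2}`
  have hsqrt : Real.sqrt η ≤ Real.exp (c / 2) * (q : ℝ) ^ (γ / 2) := by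
    have h1 : η ≤ Real.exp c * (q : ℝ) ^ γ := by
      have h2 := hc q χ η h
      calc η = Real.exp (Real.log η) := (Real.exp_log hη0).symm
        _ ≤ Real.exp (γ * Real.log q + c) := Real.exp_le_exp.mpr h2
        _ = Real.exp c * (q : ℝ) ^ γ := by
            rw [Real.exp_add, Real.rpow_def_of_pos hq0]; ring_nf
    calc Real.sqrt η ≤ Real.sqrt (Real.exp c * (q : ℝ) ^ γ) := Real.sqrt_le_sqrt h1
      _ = Real.exp (c / 2) * (q : ℝ) ^ (γ / 2) := by
          rw [Real.sqrt_mul (Real.exp_pos c).le, Real.sqrt_eq_rpow, Real.sqrt_eq_rpow,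
            ← Real.exp_mul, ← Real.rpow_mul hq0.le]
          ring_nf
  -- `log q ≤ (2/γ) q^{γ/2}`
  have hlogq : Real.log q ≤ 2 / γ * (q : ℝ) ^ (γ / 2) := by
    have := Real.log_le_rpow_div hq0.le (half_pos hγ)
    calc Real.log q ≤ (q : ℝ) ^ (γ / 2) / (γ / 2) := this
      _ = 2 / γ * (q : ℝ) ^ (γ / 2) := by field_simp
  have hqγ1 : 1 ≤ (q : ℝ) ^ γ := Real.one_le_rpow hq1 hγ.le
  have hhalf : (q : ℝ) ^ (γ / 2) * (q : ℝ) ^ (γ / 2) = (q : ℝ) ^ γ := by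
    rw [← Real.rpow_add hq0]; ring_nf
  calc 1 + Real.log x ≤ 1 + Real.sqrt η * Real.log q := by linarith
    _ ≤ 1 + (Real.exp (c / 2) * (q : ℝ) ^ (γ / 2)) * (2 / γ * (q : ℝ) ^ (γ / 2)) := by
        gcongr
    _ = 1 + Real.exp (c / 2) * (2 / γ) * (q : ℝ) ^ γ := by rw [← hhalf]; ring
    _ ≤ (q : ℝ) ^ γ + Real.exp (c / 2) * (2 / γ) * (q : ℝ) ^ γ := by linarith
    _ = (1 + Real.exp (c / 2) * (2 / γ)) * (q : ℝ) ^ γ := by ring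

/-- `1 + log x ≤ (1 + 1/b) x^b` for `x ≥ 1`, `b > 0`. [folklore] -/
theorem one_add_log_le_mul_rpow {x b : ℝ} (hx : 1 ≤ x) (hb : 0 < b) :
    1 + Real.log x ≤ (1 + 1 / b) * x ^ b := by
  have h1 : Real.log x ≤ x ^ b / b := Real.log_le_rpow_div (by linarith) hb
  have h2 : 1 ≤ x ^ b := Real.one_le_rpow hx hb.le
  calc 1 + Real.log x ≤ x ^ b + x ^ b / b := by linarith
    _ = (1 + 1 / b) * x ^ b := by ring

namespace TaoTeravainen

/-! ### The exponent bookkeeping of (2.9) at `k = 0` -/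

/-- For `0 < ε₀ ≤ 1/2` and `q^{1/2+ε₀} ≤ x` (`q ≥ 1`):
`q^{1/2+ε₀/10} x^{3ε₀/20} x^{ε₀/4} ≤ x · x^{-ε₀/2}` (the source's (2.9) at `k = 0`: the power
saving `x^{-ε₀}`-type in the Type I error term). [cite: TaoTeravainen2021, (2.9)] -/
theorem rpow_bookkeeping {q x ε₀ : ℝ} (hq : 1 ≤ q) (hε₀ : 0 < ε₀) (hε₀1 : ε₀ ≤ 1 / 2)
    (hx : q ^ ((1 : ℝ) / 2 + ε₀) ≤ x) :
    q ^ ((1 : ℝ) / 2 + ε₀ / 10) * x ^ (3 * ε₀ / 20) * x ^ (ε₀ / 4) ≤ x * x ^ (-(ε₀ / 2)) := by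
  have hq0 : 0 < q := by linarith
  have hx1 : 1 ≤ x := le_trans (Real.one_le_rpow hq (by linarith)) hx
  have hx0 : 0 < x := by linarith
  -- `q ≤ x^{1/(1/2+ε₀)}`
  have hα : 0 < (1 : ℝ) / 2 + ε₀ := by linarith
  have hqx : q ≤ x ^ (1 / ((1 : ℝ) / 2 + ε₀)) := by
    have := Real.rpow_le_rpow (by positivity) hx (le_of_lt (one_div_pos.mpr hα))
    rwa [← Real.rpow_mul hq0.le, mul_one_div_cancel hα.ne', Real.rpow_one] at this
  -- `q^{1/2+ε₀/10} ≤ x^{θ}`, `θ = (1/2+ε₀/10)/(1/2+ε₀) ≤ 1 - 9ε₀/10`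
  set θ : ℝ := ((1 : ℝ) / 2 + ε₀ / 10) / ((1 : ℝ) / 2 + ε₀) with hθ
  have hθle : θ ≤ 1 - 9 * ε₀ / 10 := by
    rw [hθ, div_le_iff₀ hα]
    nlinarith
  have h1 : q ^ ((1 : ℝ) / 2 + ε₀ / 10) ≤ x ^ θ := by
    calc q ^ ((1 : ℝ) / 2 + ε₀ / 10) ≤ (x ^ (1 / ((1 : ℝ) / 2 + ε₀))) ^ ((1 : ℝ) / 2 + ε₀ / 10) :=
          Real.rpow_le_rpow hq0.le hqx (by linarith)
      _ = x ^ θ := by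
          rw [← Real.rpow_mul hx0.le, hθ]
          congr 1
          field_simp
  calc q ^ ((1 : ℝ) / 2 + ε₀ / 10) * x ^ (3 * ε₀ / 20) * x ^ (ε₀ / 4)
      ≤ x ^ θ * x ^ (3 * ε₀ / 20) * x ^ (ε₀ / 4) := by gcongr
    _ = x ^ (θ + 3 * ε₀ / 20 + ε₀ / 4) := by
        rw [Real.rpow_add hx0, Real.rpow_add hx0]
    _ ≤ x ^ (1 + -(ε₀ / 2)) := Real.rpow_le_rpow_of_exponent_le hx1 (by linarith)
    _ = x * x ^ (-(ε₀ / 2)) := by rw [Real.rpow_add hx0, Real.rpow_one]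

end TaoTeravainen

open TaoTeravainen
open Literature.NumberTheory.LFunctions.SiegelZero (excPrimes)

/-- **Proposition 8.1 at `k = 0`, `ℓ ≥ 1`, from Lemma 3.7.**
[cite: TaoTeravainen2021, §8 (the case ℓ > 0), Lemma 3.7, (2.9), (2.11), (1.4)] -/
theorem TaoTeravainen2021_prop81_k0_of_lemma37 (h37 : TaoTeravainen2021_lemma37_k0) :
    TaoTeravainen2021_prop81_k0 := by
  intro H hH hH1 ψ hψ
  refine ⟨1 / 2, by norm_num, fun ε₀ hε₀ hε₀1 => ?_⟩
  set ℓ : ℕ := #H with hℓdef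
  have hℓ1 : 1 ≤ ℓ := card_pos.mpr hH
  have hℓ1' : (1 : ℝ) ≤ ℓ := by exact_mod_cast hℓ1
  have hℓ0 : (0 : ℝ) < ℓ := by linarith
  obtain ⟨M, hM1, hM⟩ := hψ.exists_bound
  have hM0 : 0 ≤ M := by linarith
  -- Lemma 3.7 at `ε = ε₀/10`
  obtain ⟨C₇, hC₇⟩ := h37 H hH hH1 (ε₀ / 10) (by positivity)
  set C₇' : ℝ := max C₇ 0 with hC₇'
  have hC₇'0 : 0 ≤ C₇' := le_max_right _ _
  -- the divisor bound at `1/(32ℓ)`, `1 + log x ≪ q^{1/(32ℓ)}`, and `q^{-ε₀/4} ≪ log^{-1/10} η`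
  obtain ⟨Cd, hCd1, hCd⟩ := exists_card_divisors_le_mul_rpow (ε := 1 / (32 * ℓ)) (by positivity)
  obtain ⟨Kl, hKl1, hKl⟩ := exists_one_add_log_le_rpow (γ := 1 / (32 * ℓ)) (by positivity)
  obtain ⟨Ks, hKs0, hKs⟩ := exists_rpow_neg_le_div (ε := ε₀ / 4) (by positivity)
  -- constants
  set K₁ : ℝ := (Cd ^ 2 * Kl ^ 2) ^ ℓ with hK₁
  set K₃ : ℝ := (1 + 1 / (ε₀ / (4 * ℓ))) ^ ℓ with hK₃
  refine ⟨M ^ ℓ * C₇' * (K₁ + K₃) * Ks, 10, ?_⟩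
  intro q _ χ η hS _ x hlo hhi
  have hq3 := hS.three_le
  have hq1 : (1 : ℝ) ≤ q := by exact_mod_cast NeZero.one_le
  have hq1' : (1 : ℝ) < q := by exact_mod_cast (lt_of_lt_of_le (by norm_num) hq3 : 1 < q)
  have hq0 : (0 : ℝ) < q := by linarith
  have hqne : q ≠ 0 := NeZero.ne q
  have hxlo1 : (1 : ℝ) < (q : ℝ) ^ ((1 : ℝ) / 2 + ε₀) := Real.one_lt_rpow hq1' (by linarith)
  have hx1 : (1 : ℝ) < x := hxlo1.trans_le hlo
  have hx1' : (1 : ℝ) ≤ x := hx1.le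
  have hx0 : (0 : ℝ) < x := by linarith
  /- the scale `D` and `N = ⌊D⌋` -/
  set D : ℝ := scaleD ℓ ε₀ x with hDdef
  have hDx : D = (x : ℝ) ^ (ε₀ / (10 * ℓ)) := rfl
  have hexp0 : 0 < ε₀ / (10 * ℓ) := by positivity
  have hD1 : 1 < D := by rw [hDx]; exact Real.one_lt_rpow hx1 hexp0
  have hD0 : 0 < D := by linarith
  have hDlex : D ≤ x := by
    rw [hDx]
    calc (x : ℝ) ^ (ε₀ / (10 * ℓ)) ≤ (x : ℝ) ^ (1 : ℝ) := by
          refine Real.rpow_le_rpow_of_exponent_le hx1' ?_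
          rw [div_le_one (by positivity)]
          nlinarith
      _ = x := Real.rpow_one _
  set N : ℕ := ⌊D⌋₊ with hNdef
  have hN1 : 1 ≤ N := Nat.le_floor (by simpa using hD1.le)
  have hDN : D ≤ N + 1 := (Nat.lt_floor_add_one D).le
  have hND : (N : ℝ) ≤ D := Nat.floor_le hD0.le
  have hN0 : (0 : ℝ) < N := by exact_mod_cast hN1
  have hNx : (N : ℝ) ≤ x := hND.trans hDlex
  have hlogN : 0 ≤ Real.log N := Real.log_nonneg (by exact_mod_cast hN1)
  have hlogNx : 1 + Real.log N ≤ 1 + Real.log x := by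
    linarith [Real.log_le_log hN0 hNx]
  have hlx0 : 0 ≤ 1 + Real.log x := by linarith [Real.log_nonneg hx1']
  /- the Type I bound -/
  set B : ℝ := C₇' * (q : ℝ) ^ ((1 : ℝ) / 2 + ε₀ / 10) with hBdef
  have hB0 : 0 ≤ B := by positivity
  have hT : ∀ p ∈ H.pi (fun _ => Ioc 0 N),
      |∑ n ∈ Icc 1 x, ∏ a ∈ H.attach,
          (if p a.1 a.2 ∣ n + a.1 then realChar χ ((n + a.1) / p a.1 a.2) else 0)| ≤
        B * Real.sqrt (Nat.gcd (∏ a ∈ H.attach, p a.1 a.2) q) *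
          ((x : ℝ) / ((q : ℝ) * ∏ a ∈ H.attach, (p a.1 a.2 : ℝ)) + 1) := by
    intro p hp
    have hd1 : ∀ h ∈ H, 1 ≤ piFun H p h := fun h hh => (piFun_mem hp hh).1
    have h := hC₇ q χ η hS x (piFun H p) hd1
    have e1 : ∑ n ∈ Icc 1 x, ∏ a ∈ H.attach,
          (if p a.1 a.2 ∣ n + a.1 then realChar χ ((n + a.1) / p a.1 a.2) else 0) =
        ∑ n ∈ Icc 1 x, ∏ h ∈ H,
          (if piFun H p h ∣ n + h then realChar χ ((n + h) / piFun H p h) else 0) :=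
      sum_congr rfl fun n _ => prod_attach_eq_prod_piFun H p
        (fun h d => if d ∣ n + h then realChar χ ((n + h) / d) else 0)
    have e2 : (∏ a ∈ H.attach, p a.1 a.2) = ∏ h ∈ H, piFun H p h :=
      prod_attach_eq_prod_piFun H p (fun _ d => d)
    have e3 : (∏ a ∈ H.attach, (p a.1 a.2 : ℝ)) = ∏ h ∈ H, (piFun H p h : ℝ) :=
      prod_attach_eq_prod_piFun H p (fun _ d => (d : ℝ))
    rw [e1, e2, e3]
    refine h.trans ?_
    have hP0 : 0 ≤ ∏ h ∈ H, (piFun H p h : ℝ) := prod_nonneg fun _ _ => Nat.cast_nonneg _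
    have hfac : 0 ≤ Real.sqrt (Nat.gcd (∏ h ∈ H, piFun H p h) q) *
        ((x : ℝ) / ((q : ℝ) * ∏ h ∈ H, (piFun H p h : ℝ)) + 1) :=
      mul_nonneg (Real.sqrt_nonneg _)
        (add_nonneg (div_nonneg (Nat.cast_nonneg _) (mul_nonneg hq0.le hP0)) zero_le_one)
    have hqpow : 0 ≤ (q : ℝ) ^ ((1 : ℝ) / 2 + ε₀ / 10) := Real.rpow_nonneg hq0.le _
    calc C₇ * (q : ℝ) ^ ((1 : ℝ) / 2 + ε₀ / 10) * Real.sqrt (Nat.gcd (∏ h ∈ H, piFun H p h) q) *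
          ((x : ℝ) / ((q : ℝ) * ∏ h ∈ H, (piFun H p h : ℝ)) + 1)
        = C₇ * ((q : ℝ) ^ ((1 : ℝ) / 2 + ε₀ / 10) * (Real.sqrt (Nat.gcd (∏ h ∈ H, piFun H p h) q) *
          ((x : ℝ) / ((q : ℝ) * ∏ h ∈ H, (piFun H p h : ℝ)) + 1))) := by ring
      _ ≤ C₇' * ((q : ℝ) ^ ((1 : ℝ) / 2 + ε₀ / 10) * (Real.sqrt (Nat.gcd (∏ h ∈ H, piFun H p h) q) *
          ((x : ℝ) / ((q : ℝ) * ∏ h ∈ H, (piFun H p h : ℝ)) + 1))) :=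
          mul_le_mul_of_nonneg_right (le_max_left _ _) (mul_nonneg hqpow hfac)
      _ = B * Real.sqrt (Nat.gcd (∏ h ∈ H, piFun H p h) q) *
          ((x : ℝ) / ((q : ℝ) * ∏ h ∈ H, (piFun H p h : ℝ)) + 1) := by rw [hBdef]; ring
  have hmain := abs_sum_prod_sharp_le χ hψ hM (scaleR η x) hD1 hDN H x hB0 hT
  rw [← hℓdef] at hmain
  /- the two terms -/
  set A : ℝ := (#q.divisors : ℝ) ^ 2 * (1 + Real.log N) ^ 2 with hAdef
  set E : ℝ := (N : ℝ) * Real.sqrt N * (1 + Real.log N) with hEdef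
  have hA0 : 0 ≤ A := by positivity
  have hE0 : 0 ≤ E := by positivity
  -- `1 + log x ≤ Kl q^{1/(32ℓ)}` and `τ(q) ≤ Cd q^{1/(32ℓ)}`
  have hlogx : 1 + Real.log x ≤ Kl * (q : ℝ) ^ (1 / (32 * (ℓ : ℝ))) := hKl q χ η hS x hx1' hhi
  have hτq : (#q.divisors : ℝ) ≤ Cd * (q : ℝ) ^ (1 / (32 * (ℓ : ℝ))) := hCd q hqne
  have hqγ0 : 0 ≤ (q : ℝ) ^ (1 / (32 * (ℓ : ℝ))) := Real.rpow_nonneg hq0.le _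
  -- Term 1: `A^ℓ ≤ K₁ q^{1/8}`
  have hA : A ≤ Cd ^ 2 * Kl ^ 2 * (q : ℝ) ^ (1 / (8 * (ℓ : ℝ))) := by
    have h1 : (#q.divisors : ℝ) ^ 2 ≤ (Cd * (q : ℝ) ^ (1 / (32 * (ℓ : ℝ)))) ^ 2 :=
      pow_le_pow_left₀ (Nat.cast_nonneg _) hτq 2
    have h2 : (1 + Real.log N) ^ 2 ≤ (Kl * (q : ℝ) ^ (1 / (32 * (ℓ : ℝ)))) ^ 2 :=
      pow_le_pow_left₀ (by linarith) (hlogNx.trans hlogx) 2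
    have h4 : ((q : ℝ) ^ (1 / (32 * (ℓ : ℝ)))) ^ 4 = (q : ℝ) ^ (1 / (8 * (ℓ : ℝ))) := by
      rw [← Real.rpow_natCast, ← Real.rpow_mul hq0.le]
      congr 1
      push_cast
      rw [div_mul_eq_mul_div, one_mul, div_eq_div_iff (by positivity) (by positivity)]
      ring
    calc A = (#q.divisors : ℝ) ^ 2 * (1 + Real.log N) ^ 2 := rfl
      _ ≤ (Cd * (q : ℝ) ^ (1 / (32 * (ℓ : ℝ)))) ^ 2 * (Kl * (q : ℝ) ^ (1 / (32 * (ℓ : ℝ)))) ^ 2 :=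
          mul_le_mul h1 h2 (sq_nonneg _) (sq_nonneg _)
      _ = Cd ^ 2 * Kl ^ 2 * ((q : ℝ) ^ (1 / (32 * (ℓ : ℝ)))) ^ 4 := by ring
      _ = Cd ^ 2 * Kl ^ 2 * (q : ℝ) ^ (1 / (8 * (ℓ : ℝ))) := by rw [h4]
  have hAℓ : A ^ ℓ ≤ K₁ * (q : ℝ) ^ ((1 : ℝ) / 8) := by
    have h8 : ((q : ℝ) ^ (1 / (8 * (ℓ : ℝ)))) ^ ℓ = (q : ℝ) ^ ((1 : ℝ) / 8) := by
      rw [← Real.rpow_natCast, ← Real.rpow_mul hq0.le]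
      congr 1
      rw [div_mul_eq_mul_div, one_mul, div_eq_div_iff (by positivity) (by positivity)]
      ring
    calc A ^ ℓ ≤ (Cd ^ 2 * Kl ^ 2 * (q : ℝ) ^ (1 / (8 * (ℓ : ℝ)))) ^ ℓ := pow_le_pow_left₀ hA0 hA ℓ
      _ = K₁ * (q : ℝ) ^ ((1 : ℝ) / 8) := by rw [mul_pow, h8, hK₁]
  have hterm1 : (q : ℝ) ^ ((1 : ℝ) / 2 + ε₀ / 10) / q * A ^ ℓ ≤ K₁ * (q : ℝ) ^ (-(ε₀ / 4)) := by
    have hK₁0 : 0 ≤ K₁ := by rw [hK₁]; positivity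
    have h1 : (q : ℝ) ^ ((1 : ℝ) / 2 + ε₀ / 10) / q = (q : ℝ) ^ (-(1 : ℝ) / 2 + ε₀ / 10) := by
      rw [div_eq_mul_inv, ← Real.rpow_neg_one, ← Real.rpow_add hq0]
      congr 1; ring
    rw [h1]
    calc (q : ℝ) ^ (-(1 : ℝ) / 2 + ε₀ / 10) * A ^ ℓ
        ≤ (q : ℝ) ^ (-(1 : ℝ) / 2 + ε₀ / 10) * (K₁ * (q : ℝ) ^ ((1 : ℝ) / 8)) :=
          mul_le_mul_of_nonneg_left hAℓ (Real.rpow_nonneg hq0.le _)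
      _ = K₁ * (q : ℝ) ^ (-(1 : ℝ) / 2 + ε₀ / 10 + 1 / 8) := by
          rw [Real.rpow_add hq0 (-(1 : ℝ) / 2 + ε₀ / 10) (1 / 8)]; ring
      _ ≤ K₁ * (q : ℝ) ^ (-(ε₀ / 4)) := by
          refine mul_le_mul_of_nonneg_left (Real.rpow_le_rpow_of_exponent_le hq1 ?_) hK₁0
          linarith
  -- Term 2: `E^ℓ ≤ x^{3ε₀/20} K₃ x^{ε₀/4}`
  have hE : E ≤ D ^ ((3 : ℝ) / 2) * (1 + Real.log x) := by
    have h1 : (N : ℝ) * Real.sqrt N ≤ D * Real.sqrt D :=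
      mul_le_mul hND (Real.sqrt_le_sqrt hND) (Real.sqrt_nonneg _) hD0.le
    have h2 : D * Real.sqrt D = D ^ ((3 : ℝ) / 2) := by
      rw [Real.sqrt_eq_rpow, ← Real.rpow_one_add' hD0.le (by norm_num)]
      norm_num
    calc E = (N : ℝ) * Real.sqrt N * (1 + Real.log N) := rfl
      _ ≤ D * Real.sqrt D * (1 + Real.log x) := mul_le_mul h1 hlogNx (by linarith) (by positivity)
      _ = D ^ ((3 : ℝ) / 2) * (1 + Real.log x) := by rw [h2]
  have hDpow : (D ^ ((3 : ℝ) / 2)) ^ ℓ = (x : ℝ) ^ (3 * ε₀ / 20) := by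
    rw [← Real.rpow_natCast, ← Real.rpow_mul hD0.le, hDx, ← Real.rpow_mul hx0.le]
    congr 1
    rw [div_mul_eq_mul_div, div_mul_eq_mul_div, div_eq_div_iff (by positivity) (by positivity)]
    ring
  have hlogpow : (1 + Real.log x) ^ ℓ ≤ K₃ * (x : ℝ) ^ (ε₀ / 4) := by
    have hb : 0 < ε₀ / (4 * (ℓ : ℝ)) := by positivity
    have h1 := one_add_log_le_mul_rpow hx1' hb
    have h2 : ((x : ℝ) ^ (ε₀ / (4 * (ℓ : ℝ)))) ^ ℓ = (x : ℝ) ^ (ε₀ / 4) := by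
      rw [← Real.rpow_natCast, ← Real.rpow_mul hx0.le]
      congr 1
      rw [div_mul_eq_mul_div, div_eq_div_iff (by positivity) (by positivity)]
      ring
    calc (1 + Real.log x) ^ ℓ ≤ ((1 + 1 / (ε₀ / (4 * (ℓ : ℝ)))) * (x : ℝ) ^ (ε₀ / (4 * (ℓ : ℝ)))) ^ ℓ :=
          pow_le_pow_left₀ hlx0 h1 ℓ
      _ = K₃ * (x : ℝ) ^ (ε₀ / 4) := by rw [mul_pow, h2, hK₃]
  have hK₃0 : 0 ≤ K₃ := by rw [hK₃]; positivity
  have hEℓ : E ^ ℓ ≤ (x : ℝ) ^ (3 * ε₀ / 20) * (K₃ * (x : ℝ) ^ (ε₀ / 4)) := by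
    calc E ^ ℓ ≤ (D ^ ((3 : ℝ) / 2) * (1 + Real.log x)) ^ ℓ := pow_le_pow_left₀ hE0 hE ℓ
      _ = (D ^ ((3 : ℝ) / 2)) ^ ℓ * (1 + Real.log x) ^ ℓ := mul_pow _ _ _
      _ ≤ (x : ℝ) ^ (3 * ε₀ / 20) * (K₃ * (x : ℝ) ^ (ε₀ / 4)) := by
          rw [hDpow]
          exact mul_le_mul_of_nonneg_left hlogpow (Real.rpow_nonneg hx0.le _)
  have hterm2 : (q : ℝ) ^ ((1 : ℝ) / 2 + ε₀ / 10) * E ^ ℓ / x ≤ K₃ * (q : ℝ) ^ (-(ε₀ / 4)) := by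
    have hbook := rpow_bookkeeping hq1 hε₀ hε₀1 hlo
    have h1 : (q : ℝ) ^ ((1 : ℝ) / 2 + ε₀ / 10) * E ^ ℓ ≤ K₃ * (x * (x : ℝ) ^ (-(ε₀ / 2))) := by
      calc (q : ℝ) ^ ((1 : ℝ) / 2 + ε₀ / 10) * E ^ ℓ
          ≤ (q : ℝ) ^ ((1 : ℝ) / 2 + ε₀ / 10) * ((x : ℝ) ^ (3 * ε₀ / 20) * (K₃ * (x : ℝ) ^ (ε₀ / 4))) :=
            mul_le_mul_of_nonneg_left hEℓ (Real.rpow_nonneg hq0.le _)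
        _ = K₃ * ((q : ℝ) ^ ((1 : ℝ) / 2 + ε₀ / 10) * (x : ℝ) ^ (3 * ε₀ / 20) * (x : ℝ) ^ (ε₀ / 4)) := by
            ring
        _ ≤ K₃ * (x * (x : ℝ) ^ (-(ε₀ / 2))) := mul_le_mul_of_nonneg_left hbook hK₃0
    have h2 : (x : ℝ) ^ (-(ε₀ / 2)) ≤ (q : ℝ) ^ (-(ε₀ / 4)) := by
      have hxq : (q : ℝ) ^ ((1 : ℝ) / 2) ≤ x :=
        le_trans (Real.rpow_le_rpow_of_exponent_le hq1 (by linarith)) hlo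
      calc (x : ℝ) ^ (-(ε₀ / 2)) ≤ ((q : ℝ) ^ ((1 : ℝ) / 2)) ^ (-(ε₀ / 2)) :=
            Real.rpow_le_rpow_of_nonpos (Real.rpow_pos_of_pos hq0 _) hxq (by linarith)
        _ = (q : ℝ) ^ (-(ε₀ / 4)) := by
            rw [← Real.rpow_mul hq0.le]; congr 1; ring
    rw [div_le_iff₀ hx0]
    calc (q : ℝ) ^ ((1 : ℝ) / 2 + ε₀ / 10) * E ^ ℓ ≤ K₃ * (x * (x : ℝ) ^ (-(ε₀ / 2))) := h1
      _ = K₃ * (x : ℝ) ^ (-(ε₀ / 2)) * x := by ring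
      _ ≤ K₃ * (q : ℝ) ^ (-(ε₀ / 4)) * x := by
          refine mul_le_mul_of_nonneg_right (mul_le_mul_of_nonneg_left h2 hK₃0) hx0.le
  /- conclusion -/
  have hKsb := hKs q χ η hS
  have hL0 : 0 < Real.log η ^ ((1 : ℝ) / 10) :=
    Real.rpow_pos_of_pos (Real.log_pos (by linarith [hS.ten_le])) _
  have havg : tupleAverage (liouvilleSiegelSharp χ ψ (scaleR η x) (scaleD ℓ ε₀ x)) H x =
      (∑ n ∈ Icc 1 x, ∏ h ∈ H, liouvilleSiegelSharp χ ψ (scaleR η x) D (n + h)) / x := rfl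
  rw [havg, abs_div, abs_of_pos hx0, div_le_iff₀ hx0]
  have hMC : 0 ≤ M ^ ℓ * C₇' := by positivity
  calc |∑ n ∈ Icc 1 x, ∏ h ∈ H, liouvilleSiegelSharp χ ψ (scaleR η x) D (n + h)|
      ≤ M ^ ℓ * B * ((x : ℝ) / q * A ^ ℓ + E ^ ℓ) := hmain
    _ = M ^ ℓ * C₇' * ((q : ℝ) ^ ((1 : ℝ) / 2 + ε₀ / 10) / q * A ^ ℓ +
          (q : ℝ) ^ ((1 : ℝ) / 2 + ε₀ / 10) * E ^ ℓ / x) * x := by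
        rw [hBdef]; field_simp
    _ ≤ M ^ ℓ * C₇' * (K₁ * (q : ℝ) ^ (-(ε₀ / 4)) + K₃ * (q : ℝ) ^ (-(ε₀ / 4))) * x := by
        refine mul_le_mul_of_nonneg_right (mul_le_mul_of_nonneg_left (add_le_add hterm1 hterm2) hMC)
          hx0.le
    _ = M ^ ℓ * C₇' * (K₁ + K₃) * (q : ℝ) ^ (-(ε₀ / 4)) * x := by ring
    _ ≤ M ^ ℓ * C₇' * (K₁ + K₃) * (Ks / Real.log η ^ ((1 : ℝ) / 10)) * x := by
        refine mul_le_mul_of_nonneg_right (mul_le_mul_of_nonneg_left hKsb ?_) hx0.le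
        have hK₁0 : 0 ≤ K₁ := by rw [hK₁]; positivity
        positivity
    _ = M ^ ℓ * C₇' * (K₁ + K₃) * Ks / Real.log η ^ ((1 : ℝ) / 10) * x := by ring

end Literature.Barriers.Parity
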